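import Mathlib

/-!
# Manin–Gamma cell (pub-manin-gamma0): the square-class bookkeeping of T1 §5, by exhaustive kernel check (seat p1)

`proofs/T1_lead.md` Prop. 5.1 (and the independent re-derivations review/ALGEBRA_p3.md,
review/ALGEBRA_TATE_p1.md) is a finite case analysis in the group `𝒮 ≅ (ℚ^×/ℚ^{×2})²` of pairs of
square classes.  Only the classes of `−1`, `2` and of the (at most two) odd primes `p, q` with
`k_{p^·}, k_{q^·} ≠ 1` ever occur, so every configuration lives in a finite 𝔽₂-vector space and the whole
analysis can be checked by `decide`.  This file does exactly that.

ENCODING.  A square class supported on `{−1, 2, p}` is a triple of bits `(n, t, r)` = (sign is −, 2 occurs,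
p occurs); supported on `{−1, p, q}` a triple `(n, r, s)`.  Multiplication = componentwise `xor`.  An element
of `𝒮` is recorded by its first two coordinates `(d₁, d₂)` (the third is `d₁d₂`).  «positive» = `n = false`.
`p* = (−1)^{(p−1)/2} p` is encoded by the bit `pneg` (= `true` iff `p ≡ 3 (mod 4)`).

HYPOTHESES (= T1_lead Prop. 4.6 (K),(i)–(iv) + AppA (D4), restricted to the case at hand):
* `k_p = ((p*)^{x₁}, (p*)^{x₂})` with `(x₁,x₂) ≠ (0,0)`; in case (β) `k₂ = (c₁, c₂)` with `c_i ∈ {±1, ±2}`,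
  `(c₁,c₂) ≠ (1,1)`; in case (α) `k_q = ((q*)^{y₁}, (q*)^{y₂})`, `(y₁,y₂) ≠ (0,0)`;
* `k := k_p·k₂` (resp. `k_p·k_q`) has both coordinates positive, non-trivial and distinct (4.6 (iii),(iv));
* `A, B, A+B > 0` have classes `a, b, c` (positive); `k_{T₁} = (a·c, −a)`, `k_{T₂} = (a, −a·b)` (AppA D4) lie in
  `𝒦 = {1, k_p, k₂, k}` resp. `{1, k_p, k_q, k}` (4.6 (K) together with §5 Step 2: these four elements exhaust 𝒦).
CONCLUSIONS.
* `caseAlpha_impossible` : case (α) (two odd primes) has NO admissible configuration (T1_lead §5 CASE (α)):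
  the bundled hypothesis `alphaHypothesis` is identically `false`.
* `caseBeta_classification` : in case (β) (`betaHypothesis = true`), necessarily (`betaConclusion = true`):
  `p ≡ 3 (mod 4)`, `k_p = (1, −p)`, `k₂ = (2, c₂)` with `c₂ ∈ {−1, −2}`, and `(a, b, c) = (1, p, 2)` with `c₂ = −1`
  (OPTION 2 — the family) or `(a, b, c) = (2, 1, 1)` with `c₂ = −2` (OPTION 3 — killed separately by
  `ManinGamma.no_sol_sq_sub_psq` / `no_pyth_odd_odd` in `Endgame.lean` together with the halving point of AppA A4).
* `single_odd_impossible`, `single_two_impossible` : |S| = 1 is impossible (T1_lead §5 Step 1 / CASE (γ)).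
The reduction «at most two of the k_Q are non-trivial, and only −1, 2 and those primes occur» is the
independence argument of T1_lead §5 Step 1–2 (review/ALGEBRA_TATE_p1 §1–2) and is not re-encoded here.
FAITHFULNESS of the 3-bit encoding: every element of `𝒦 = {1, k_p, k₂, k_pk₂}` (resp. `{1, k_p, k_q, k_pk_q}`) has
coordinates in `⟨−1, 2, p⟩` (resp. `⟨−1, p, q⟩`); since `k_{T₁} = (A(A+B), −A)` and `k_{T₂} = (A, −AB)` lie in 𝒦,
the classes of `A`, `B`, `A+B` lie in that subgroup too, and being classes of positive rationals they have sign
bit 0 — so quantifying `a, b, c` over the positive classes of the subgroup loses nothing.  Likewise `k₂` with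
coordinates in `{±1}` (the sub-case `2^e ∥ N`, `e ∈ {3,4}`) is the instance `t₁ = t₂ = false`, which the
classification shows to be inconsistent (`t₁ = true` is forced): this is «e₂ ≥ 5» of Prop. 5.1.
-/

namespace ManinGamma.SquareClasses

/-- A square class supported on three generators, as three bits; multiplication is `xor`. -/
abbrev Cl := Bool × Bool × Bool

/-- Product of square classes (componentwise xor of exponent bits). -/
def mul (x y : Cl) : Cl := (xor x.1 y.1, xor x.2.1 y.2.1, xor x.2.2 y.2.2)

/-- The trivial class. -/
def one : Cl := (false, false, false)

/-- The class of `−1` (first bit). -/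
def neg : Cl := (true, false, false)

/-- `x` raised to the bit `e` (i.e. `x` if `e`, else `1`). -/
def pw (e : Bool) (x : Cl) : Cl := if e then x else one

/-- A class is «positive» when its sign bit is off. -/
def pos (x : Cl) : Bool := !x.1

/-- An element of `𝒮`, recorded by its first two coordinates. -/
abbrev K := Cl × Cl

/-- Componentwise product in `𝒮`. -/
def kmul (u v : K) : K := (mul u.1 v.1, mul u.2 v.2)

/-- Membership of `z` in the four-element group `{1, u, v, u·v}`. -/
def inK (z u v : K) : Bool := (z == (one, one)) || (z == u) || (z == v) || (z == kmul u v)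

/-- The conditions 4.6 (iii),(iv) on `k = κ(R)`: both recorded coordinates positive, non-trivial, distinct. -/
def admissibleK (k : K) : Bool := pos k.1 && pos k.2 && (k.1 != one) && (k.2 != one) && (k.1 != k.2)

/-! ### Case (β): bits are (−1, 2, p). -/

/-- Class of `p*`: `p` with the sign bit on iff `p ≡ 3 (mod 4)`. -/
def pstarB (pneg : Bool) : Cl := (pneg, false, true)
/-- Class of `2`. -/
def twoB : Cl := (false, true, false)
/-- Class of `p` (positive). -/
def pB : Cl := (false, false, true)
/-- `k_p = ((p*)^{x₁}, (p*)^{x₂})`. -/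
def kpB (pneg x₁ x₂ : Bool) : K := (pw x₁ (pstarB pneg), pw x₂ (pstarB pneg))
/-- A class in `{±1, ±2}` from two bits (sign, 2). -/
def cB (n t : Bool) : Cl := (n, t, false)
/-- A positive class in `⟨2, p⟩` from two bits. -/
def aB (t r : Bool) : Cl := (false, t, r)

/-- The Option-2 / Option-3 dichotomy of case (β) as a Boolean predicate of the configuration:
`p ≡ 3 (4)` (`pneg`), `k_p = (1, p*)` (`x₁ = 0, x₂ = 1`), `k₂ = (2, c₂)` (`c₁ = +2`, `c₂ < 0`), and
either `(a, b, c) = (1, p, 2)` with `c₂ = −1`, or `(a, b, c) = (2, 1, 1)` with `c₂ = −2`. -/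
def betaConclusion (pneg x₁ x₂ n₁ t₁ n₂ t₂ ta ra tb rb tc rc : Bool) : Bool :=
  pneg && (!x₁ && x₂) && (!n₁ && t₁) && n₂ &&
  ( ((aB ta ra == one) && (aB tb rb == pB) && (aB tc rc == twoB) && !t₂)
    || ((aB ta ra == twoB) && (aB tb rb == one) && (aB tc rc == one) && t₂) )

/-- The hypotheses of case (β) bundled into one Boolean: `k_p ≠ 1`, `k₂ ≠ 1`, `k = k_p k₂` admissible (4.6 (iii),(iv)),
`k_{T₁} ∈ 𝒦`, `k_{T₂} ∈ 𝒦`. -/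
def betaHypothesis (pneg x₁ x₂ n₁ t₁ n₂ t₂ ta ra tb rb tc rc : Bool) : Bool :=
  (x₁ || x₂) && ((n₁ || t₁) || (n₂ || t₂)) &&
  admissibleK (kmul (kpB pneg x₁ x₂) (cB n₁ t₁, cB n₂ t₂)) &&
  inK (mul (aB ta ra) (aB tc rc), mul neg (aB ta ra)) (kpB pneg x₁ x₂) (cB n₁ t₁, cB n₂ t₂) &&
  inK (aB ta ra, mul neg (mul (aB ta ra) (aB tb rb))) (kpB pneg x₁ x₂) (cB n₁ t₁, cB n₂ t₂)

/-- **CASE (β) classification** (T1_lead Prop. 5.1, CASE (β) incl. Options 1–3): every admissible configuration has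
`p ≡ 3 (4)`, `k_p = (1, −p)`, `k₂ = (2, c₂)`, and either Option 2 data `(a,b,c) = (1,p,2)`, `c₂ = −1`, or Option 3 data
`(a,b,c) = (2,1,1)`, `c₂ = −2` — i.e. `betaHypothesis … = true → betaConclusion … = true`. -/
theorem caseBeta_classification :
    ∀ (pneg x₁ x₂ n₁ t₁ n₂ t₂ ta ra tb rb tc rc : Bool),
      betaHypothesis pneg x₁ x₂ n₁ t₁ n₂ t₂ ta ra tb rb tc rc = true →
      betaConclusion pneg x₁ x₂ n₁ t₁ n₂ t₂ ta ra tb rb tc rc = true := by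
  decide

/-! ### Case (α): bits are (−1, p, q). -/

/-- Class of `p*` in case (α). -/
def pstarA (pneg : Bool) : Cl := (pneg, true, false)
/-- Class of `q*` in case (α). -/
def qstarA (qneg : Bool) : Cl := (qneg, false, true)
/-- `k_p` in case (α). -/
def kpA (pneg x₁ x₂ : Bool) : K := (pw x₁ (pstarA pneg), pw x₂ (pstarA pneg))
/-- `k_q` in case (α). -/
def kqA (qneg y₁ y₂ : Bool) : K := (pw y₁ (qstarA qneg), pw y₂ (qstarA qneg))
/-- A positive class in `⟨p, q⟩`. -/
def aA (r s : Bool) : Cl := (false, r, s)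

/-- The hypotheses of case (α) bundled into one Boolean: `k_p ≠ 1`, `k_q ≠ 1`, `k = k_p k_q` admissible,
`k_{T₁} ∈ 𝒦`, `k_{T₂} ∈ 𝒦`. -/
def alphaHypothesis (pneg qneg x₁ x₂ y₁ y₂ ra sa rb sb rc sc : Bool) : Bool :=
  (x₁ || x₂) && (y₁ || y₂) &&
  admissibleK (kmul (kpA pneg x₁ x₂) (kqA qneg y₁ y₂)) &&
  inK (mul (aA ra sa) (aA rc sc), mul neg (aA ra sa)) (kpA pneg x₁ x₂) (kqA qneg y₁ y₂) &&
  inK (aA ra sa, mul neg (mul (aA ra sa) (aA rb sb))) (kpA pneg x₁ x₂) (kqA qneg y₁ y₂)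

/-- **CASE (α) is impossible** (T1_lead Prop. 5.1, CASE (α)): with two odd primes contributing there is no admissible
configuration — positivity of `k` forces `p ≡ q ≡ 1 (4)`, and then `k_{T₁}` (which has a negative coordinate) cannot lie in 𝒦. -/
theorem caseAlpha_impossible :
    ∀ (pneg qneg x₁ x₂ y₁ y₂ ra sa rb sb rc sc : Bool),
      alphaHypothesis pneg qneg x₁ x₂ y₁ y₂ ra sa rb sb rc sc = false := by
  decide

/-- |S| = 1 with S = {p^·} (p odd) is impossible: `k = k_p` cannot have two distinct non-trivial positive coordinates. -/
theorem single_odd_impossible :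
    ∀ (pneg x₁ x₂ : Bool), admissibleK (kpA pneg x₁ x₂) = true → False := by
  decide

/-- |S| = 1 with S = {2^e} is impossible: `k = k₂` with coordinates in `{±1, ±2}` positive, i.e. in `{1, 2}`, cannot have two
distinct non-trivial coordinates. -/
theorem single_two_impossible :
    ∀ (n₁ t₁ n₂ t₂ : Bool), admissibleK (cB n₁ t₁, cB n₂ t₂) = true → False := by
  decide

end ManinGamma.SquareClasses
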